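import Mathlib
import Summits.ABC.ABC.Theses.TwistAmplification
import Summits.ABC.ABC.Theorems.TwistAmplificationSomeWindowSavingRealPeriodUpperBound
import Literature.NumberTheory.EllipticCurves.RealPeriod
import HarnessLib

/-!
# Route TwistAmplification — crux `SomeWindowSaving` (stmt-ABC-1976), line `Sketch`:
  calibration of the period face, `PeriodLowerBound ↔ WeakGeneralizedSzpiro` (stub `stub_periodCalibration`)

Card A of line `Sketch` (`Ideas/period-quantisation-rank-zero-twist.md`) routes the crux through the
period lower bound `PeriodLowerBound` (`Ω(W₀) ≥ C·N^{-K}` for every global minimal model `W₀/ℤ`,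
`Ω = (W₀ ⊗ ℝ).realPeriod = 2∫_{ψ>0}dx/√ψ`).  This file makes the content of that intermediate target
EXACT:

* `normalizedPeriodIntegral_lower`: `1/2 ≤ ∫_{p>0} ds/√p` for every normalized cubic
  `p = 4s³ − G₂s − G₃` (`|G₂|,|G₃| ≤ 1`, `G₂³ − 27G₃² ≠ 0`) — compare with `∫_1^∞ (6s³)^{-1/2}`.
* `realPeriodLowerBound`: `Ω(W₀ ⊗ ℝ) ≥ (M⁺)^{-1/12}` for every integral model with `Δ ≠ 0`,
  `M⁺ = max(|Δ|,|c₄|³)` — the CONVERSE of A0, from the scaling reduction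
  `RealPeriodUpperBound.realPeriod_eq_scaled` (landed with stub D) and the previous bullet.
* `periodLowerBound_of_weakGenSzpiro'`: WGS (with a constant, all minimal models) ⟹ PeriodLowerBound,
  unconditionally.
* `PeriodCalibration.max_le_of_period_bounds`, `weakGenSzpiro_of_periodBounds`:
  A0 ∧ PeriodLowerBound ⟹ WGS (all minimal models, not only cofinitely), by
  `log(2+M) ≤ 24·(3M)^{1/24}`.
* `stub_periodCalibration`: A0 → (PeriodLowerBound ↔ WeakGeneralizedSzpiro) — the registered
  calibration stub.

Consequence for the line: its open core K1 (`PolyAlgebraicPart`) implies PeriodLowerBound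
(kernel-checked in the skeleton), hence — given A0 — weak generalized Szpiro for ALL curves, i.e. K1
is at least as strong as the crux (≡ cofinite WGS, `someWindowSaving_iff_cofiniteWeakGenSzpiro`).
Lands `--supports stmt-ABC-1976`.
-/

noncomputable section

-- `Summit.<Summit>.<Problem>` is the mandated summit-side namespace (CONVENTIONS §2); for the
-- single-conjunct summit `ABC` the two coincide, so the duplicate `ABC.ABC` is deliberate.
set_option linter.dupNamespace false

open WeierstrassCurve IsDedekindDomain MeasureTheory Set

namespace Summit.ABC.ABC.Theorems


/-- The two-torsion polynomial of the real model `y² = x³ − (G₂/4)x − G₃/4` evaluates to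
`4s³ − G₂s − G₃`. -/
theorem sketchLower_eval (G₂ G₃ s : ℝ) :
    (⟨0, 0, 0, -G₂ / 4, -G₃ / 4⟩ : WeierstrassCurve ℝ).twoTorsionPolynomial.toPoly.eval s =
      4 * s ^ 3 - G₂ * s - G₃ := by
  rw [WeierstrassCurve.eval_twoTorsionPolynomial]
  simp only [WeierstrassCurve.b₂, WeierstrassCurve.b₄, WeierstrassCurve.b₆]
  ring

/-- The discriminant of the real model `y² = x³ − (G₂/4)x − G₃/4` is `G₂³ − 27G₃²`. -/
theorem sketchLower_Δ (G₂ G₃ : ℝ) :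
    (⟨0, 0, 0, -G₂ / 4, -G₃ / 4⟩ : WeierstrassCurve ℝ).Δ = G₂ ^ 3 - 27 * G₃ ^ 2 := by
  simp only [WeierstrassCurve.Δ, WeierstrassCurve.b₂, WeierstrassCurve.b₄, WeierstrassCurve.b₆,
    WeierstrassCurve.b₈]
  ring

/-- The two-torsion set of the real model `y² = x³ − (G₂/4)x − G₃/4` is
`{s | 0 < 4s³ − G₂s − G₃}`. -/
theorem sketchLower_twoTorsionSet (G₂ G₃ : ℝ) :
    (⟨0, 0, 0, -G₂ / 4, -G₃ / 4⟩ : WeierstrassCurve ℝ).twoTorsionSet =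
      {s : ℝ | 0 < 4 * s ^ 3 - G₂ * s - G₃} := by
  ext s
  rw [WeierstrassCurve.mem_twoTorsionSet_iff, sketchLower_eval]
  rfl

/-- Integrability of `1/√p` on `{p > 0}` for the normalized cubic with non-zero discriminant
(from `WeierstrassCurve.integrableOn_inv_sqrt_twoTorsionPolynomial'`). -/
theorem sketchLower_integrableOn (G₂ G₃ : ℝ) (hD : G₂ ^ 3 - 27 * G₃ ^ 2 ≠ 0) :
    IntegrableOn (fun s : ℝ => (Real.sqrt (4 * s ^ 3 - G₂ * s - G₃))⁻¹)
      {s : ℝ | 0 < 4 * s ^ 3 - G₂ * s - G₃} := by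
  haveI : (⟨0, 0, 0, -G₂ / 4, -G₃ / 4⟩ : WeierstrassCurve ℝ).IsElliptic :=
    ⟨isUnit_iff_ne_zero.mpr (by rw [sketchLower_Δ]; exact hD)⟩
  have h :=
    (⟨0, 0, 0, -G₂ / 4, -G₃ / 4⟩ : WeierstrassCurve ℝ).integrableOn_inv_sqrt_twoTorsionPolynomial'
  rw [sketchLower_twoTorsionSet] at h
  refine h.congr_fun (fun s _ => ?_) (measurableSet_lt measurable_const (by fun_prop))
  simp only [sketchLower_eval]

/-- **Lower bound for the normalized period integral.**  For `|G₂|, |G₃| ≤ 1` and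
`G₂³ − 27G₃² ≠ 0`: `1/2 ≤ ∫_{p>0} ds/√p(s)` where `p(s) = 4s³ − G₂s − G₃`. [folklore] -/
theorem normalizedPeriodIntegral_lower (G₂ G₃ : ℝ) (hG₂ : |G₂| ≤ 1) (hG₃ : |G₃| ≤ 1)
    (hD : G₂ ^ 3 - 27 * G₃ ^ 2 ≠ 0) :
    (1 / 2 : ℝ) ≤
      ∫ s in {s : ℝ | 0 < 4 * s ^ 3 - G₂ * s - G₃}, (Real.sqrt (4 * s ^ 3 - G₂ * s - G₃))⁻¹ := by
  set f : ℝ → ℝ := fun s => (Real.sqrt (4 * s ^ 3 - G₂ * s - G₃))⁻¹ with hf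
  have hG₂' := abs_le.mp hG₂
  have hG₃' := abs_le.mp hG₃
  -- `Ioi 1 ⊆ {p > 0}`
  have hsub : Ioi (1 : ℝ) ⊆ {s : ℝ | 0 < 4 * s ^ 3 - G₂ * s - G₃} := by
    intro s hs
    simp only [mem_Ioi] at hs
    simp only [mem_setOf_eq]
    nlinarith [mul_pos (by linarith : (0 : ℝ) < s) (by nlinarith : (0 : ℝ) < s ^ 2)]
  have hint : IntegrableOn f {s : ℝ | 0 < 4 * s ^ 3 - G₂ * s - G₃} := sketchLower_integrableOn G₂ G₃ hD
  have hf_nn : ∀ s, 0 ≤ f s := fun s => inv_nonneg.mpr (Real.sqrt_nonneg _)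
  -- restrict to `Ioi 1`
  have h1 : ∫ s in Ioi (1 : ℝ), f s ≤ ∫ s in {s : ℝ | 0 < 4 * s ^ 3 - G₂ * s - G₃}, f s :=
    setIntegral_mono_set hint (Filter.Eventually.of_forall hf_nn)
      (Filter.Eventually.of_forall hsub)
  -- compare with `6^{-1/2} s^{-3/2}` on `Ioi 1`
  have hg_int : IntegrableOn (fun s : ℝ => s ^ (-(3 / 2) : ℝ)) (Ioi (1 : ℝ)) :=
    integrableOn_Ioi_rpow_of_lt (by norm_num) one_pos
  have h2 : ∫ s in Ioi (1 : ℝ), (Real.sqrt 6)⁻¹ * s ^ (-(3 / 2) : ℝ) ≤ ∫ s in Ioi (1 : ℝ), f s := by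
    refine setIntegral_mono_on (hg_int.const_mul _) (hint.mono_set hsub) measurableSet_Ioi ?_
    intro s hs
    simp only [mem_Ioi] at hs
    have hs0 : 0 < s := by linarith
    have hp : 0 < 4 * s ^ 3 - G₂ * s - G₃ := hsub hs
    have hple : 4 * s ^ 3 - G₂ * s - G₃ ≤ 6 * s ^ 3 := by
      nlinarith [mul_pos hs0 (by nlinarith : (0 : ℝ) < s ^ 2)]
    have hs3 : 0 < 6 * s ^ 3 := by positivity
    rw [hf]
    simp only
    calc (Real.sqrt 6)⁻¹ * s ^ (-(3 / 2) : ℝ) = (Real.sqrt (6 * s ^ 3))⁻¹ := by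
          rw [Real.sqrt_mul (by norm_num : (0 : ℝ) ≤ 6), mul_inv, Real.sqrt_eq_rpow,
            Real.sqrt_eq_rpow, ← Real.rpow_natCast, ← Real.rpow_mul hs0.le, ← Real.rpow_neg hs0.le]
          norm_num
      _ ≤ (Real.sqrt (4 * s ^ 3 - G₂ * s - G₃))⁻¹ :=
          inv_anti₀ (Real.sqrt_pos.mpr hp) (Real.sqrt_le_sqrt hple)
  -- evaluate the model integral: `∫_{Ioi 1} s^{-3/2} = 2`
  have h3 : ∫ s in Ioi (1 : ℝ), (Real.sqrt 6)⁻¹ * s ^ (-(3 / 2) : ℝ) = (Real.sqrt 6)⁻¹ * 2 := by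
    rw [integral_const_mul, integral_Ioi_rpow_of_lt (by norm_num) one_pos]
    norm_num
  -- numerics: `1/2 ≤ 2/√6`
  have h6 : Real.sqrt 6 ≤ 3 := by
    rw [show (3 : ℝ) = Real.sqrt 9 by rw [show (9 : ℝ) = 3 ^ 2 by norm_num, Real.sqrt_sq (by norm_num)]]
    exact Real.sqrt_le_sqrt (by norm_num)
  have h6pos : 0 < Real.sqrt 6 := Real.sqrt_pos.mpr (by norm_num)
  have h4 : (1 / 2 : ℝ) ≤ (Real.sqrt 6)⁻¹ * 2 := by
    rw [inv_mul_eq_div, le_div_iff₀ h6pos]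
    linarith
  linarith [h1, h2, h3, h4]



/-- An integral model whose generic fibre is elliptic has non-zero integral discriminant. -/
theorem PeriodCalibration.Δ_ne_zero_of_isElliptic (W₀ : WeierstrassCurve ℤ)
    (hE : (W₀.baseChange ℚ).IsElliptic) : W₀.Δ ≠ 0 := by
  intro h0
  have h : IsUnit ((W₀.map (algebraMap ℤ ℚ)).Δ) := hE.isUnit
  rw [WeierstrassCurve.map_Δ, h0, map_zero] at h
  exact not_isUnit_zero h

/-- **WGS ⟹ PeriodLowerBound** (given the converse real-period bound `Ω ≥ c₀ (M⁺)^{-1/12}`):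
weak generalized Szpiro with a constant for all minimal models gives a polynomial lower bound for the
real period of every minimal model.  [folklore] -/
theorem periodLowerBound_of_weakGenSzpiro
    (hlow : ∃ c₀ : ℝ, 0 < c₀ ∧ ∀ W₀ : WeierstrassCurve ℤ, W₀.Δ ≠ 0 →
      c₀ * ((max |W₀.Δ| (|W₀.c₄| ^ 3) : ℤ) : ℝ) ^ (-(1 : ℝ) / 12) ≤ (W₀.baseChange ℝ).realPeriod)
    (hwgs : ∃ K C : ℝ, ∀ W₀ : WeierstrassCurve ℤ, (W₀.baseChange ℚ).IsElliptic →
      (∀ v : HeightOneSpectrum ℤ, (W₀.baseChange ℚ).IsMinimalAt v) →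
        ((max |W₀.Δ| (|W₀.c₄| ^ 3) : ℤ) : ℝ) ≤ C * (((W₀.baseChange ℚ).conductorNorm ℤ : ℕ) : ℝ) ^ K) :
    ∃ K C : ℝ, 0 < C ∧ ∀ W₀ : WeierstrassCurve ℤ, (W₀.baseChange ℚ).IsElliptic →
      (∀ v : HeightOneSpectrum ℤ, (W₀.baseChange ℚ).IsMinimalAt v) →
        C * (((W₀.baseChange ℚ).conductorNorm ℤ : ℕ) : ℝ) ^ (-K) ≤ (W₀.baseChange ℝ).realPeriod := by
  obtain ⟨c₀, hc₀, hlow⟩ := hlow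
  obtain ⟨K, C, hwgs⟩ := hwgs
  set K' : ℝ := max K 0 with hK'
  set C' : ℝ := max C 1 with hC'
  have hC'1 : 1 ≤ C' := le_max_right _ _
  have hC'0 : 0 < C' := by linarith
  refine ⟨K' / 12, c₀ * C' ^ (-(1 : ℝ) / 12), mul_pos hc₀ (Real.rpow_pos_of_pos hC'0 _),
    fun W₀ hE hmin => ?_⟩
  haveI := hE
  set n : ℝ := (((W₀.baseChange ℚ).conductorNorm ℤ : ℕ) : ℝ) with hn
  set M : ℝ := ((max |W₀.Δ| (|W₀.c₄| ^ 3) : ℤ) : ℝ) with hM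
  have hn1 : (1 : ℝ) ≤ n := by
    rw [hn]; exact_mod_cast WeierstrassCurve.conductorNorm_pos_holds (W₀.baseChange ℚ)
  have hn0 : (0 : ℝ) < n := by linarith
  have hΔ : W₀.Δ ≠ 0 := PeriodCalibration.Δ_ne_zero_of_isElliptic W₀ hE
  have hM1 : (1 : ℝ) ≤ M := by
    rw [hM]
    have h1 : (1 : ℤ) ≤ max |W₀.Δ| (|W₀.c₄| ^ 3) := le_trans (Int.one_le_abs hΔ) (le_max_left _ _)
    exact_mod_cast h1
  have hM0 : (0 : ℝ) < M := by linarith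
  -- `M ≤ C' n^{K'}`
  have hMle : M ≤ C' * n ^ K' := by
    calc M ≤ C * n ^ K := hwgs W₀ hE hmin
      _ ≤ C' * n ^ K := mul_le_mul_of_nonneg_right (le_max_left _ _) (Real.rpow_nonneg hn0.le K)
      _ ≤ C' * n ^ K' :=
          mul_le_mul_of_nonneg_left (Real.rpow_le_rpow_of_exponent_le hn1 (le_max_left _ _)) hC'0.le
  have hCn0 : 0 < C' * n ^ K' := mul_pos hC'0 (Real.rpow_pos_of_pos hn0 _)
  -- `(C' n^{K'})^{-1/12} ≤ M^{-1/12}`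
  have hanti : (C' * n ^ K') ^ (-(1 : ℝ) / 12) ≤ M ^ (-(1 : ℝ) / 12) := by
    rw [show (-(1 : ℝ) / 12) = -((1 : ℝ) / 12) by ring, Real.rpow_neg hCn0.le, Real.rpow_neg hM0.le]
    exact inv_anti₀ (Real.rpow_pos_of_pos hM0 _) (Real.rpow_le_rpow hM0.le hMle (by norm_num))
  -- split the power of the product
  have hsplit : (C' * n ^ K') ^ (-(1 : ℝ) / 12) = C' ^ (-(1 : ℝ) / 12) * n ^ (-(K' / 12)) := by
    rw [Real.mul_rpow hC'0.le (Real.rpow_nonneg hn0.le _), ← Real.rpow_mul hn0.le]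
    congr 1
    congr 1
    ring
  calc c₀ * C' ^ (-(1 : ℝ) / 12) * n ^ (-(K' / 12))
      = c₀ * (C' * n ^ K') ^ (-(1 : ℝ) / 12) := by rw [hsplit, mul_assoc]
    _ ≤ c₀ * M ^ (-(1 : ℝ) / 12) := mul_le_mul_of_nonneg_left hanti hc₀.le
    _ ≤ (W₀.baseChange ℝ).realPeriod := hlow W₀ hΔ

/-- **Converse real-period bound.**  For every integral model with `Δ ≠ 0`:
`(M⁺)^{-1/12} ≤ Ω(W₀ ⊗ ℝ)`, `M⁺ = max(|Δ|, |c₄|³)` — from the scaling reduction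
`Ω = 2u⁻¹∫_{p>0}p^{-1/2}` (`RealPeriodUpperBound.realPeriod_eq_scaled`, landed with stub D), the absolute
lower bound `1/2 ≤ ∫_{p>0}p^{-1/2}` (`normalizedPeriodIntegral_lower`) and `u¹² ≤ M⁺`. [folklore] -/
theorem realPeriodLowerBound :
    ∃ c₀ : ℝ, 0 < c₀ ∧ ∀ W₀ : WeierstrassCurve ℤ, W₀.Δ ≠ 0 →
      c₀ * ((max |W₀.Δ| (|W₀.c₄| ^ 3) : ℤ) : ℝ) ^ (-(1 : ℝ) / 12) ≤ (W₀.baseChange ℝ).realPeriod := by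
  refine ⟨1, one_pos, fun W₀ hΔ => ?_⟩
  obtain ⟨u, G₂, G₃, hu0, hG₂, hG₃, -, hD0, hlow, -, -, hΩ⟩ :=
    RealPeriodUpperBound.realPeriod_eq_scaled W₀ hΔ
  have hI := normalizedPeriodIntegral_lower G₂ G₃ hG₂ hG₃ hD0
  set M : ℝ := ((max |W₀.Δ| (|W₀.c₄| ^ 3) : ℤ) : ℝ) with hM
  have hu12 : 0 < u ^ 12 := by positivity
  have hM0 : 0 < M := lt_of_lt_of_le hu12 hlow
  -- `M^{-1/12} ≤ (u¹²)^{-1/12} = u⁻¹`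
  have h1 : M ^ (-(1 : ℝ) / 12) ≤ (u ^ 12) ^ (-(1 : ℝ) / 12) := by
    rw [show (-(1 : ℝ) / 12) = -((1 : ℝ) / 12) by ring, Real.rpow_neg hM0.le, Real.rpow_neg hu12.le]
    exact inv_anti₀ (Real.rpow_pos_of_pos hu12 _) (Real.rpow_le_rpow hu12.le hlow (by norm_num))
  have h2 : (u ^ 12 : ℝ) ^ (-(1 : ℝ) / 12) = u⁻¹ := by
    rw [← Real.rpow_natCast, ← Real.rpow_mul hu0.le, ← Real.rpow_neg_one]; norm_num
  have h3 : 0 ≤ u⁻¹ := inv_nonneg.mpr hu0.le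
  calc 1 * M ^ (-(1 : ℝ) / 12) ≤ u⁻¹ := by rw [one_mul, ← h2]; exact h1
    _ ≤ 2 * u⁻¹ *
        ∫ s in {s : ℝ | 0 < 4 * s ^ 3 - G₂ * s - G₃}, (Real.sqrt (4 * s ^ 3 - G₂ * s - G₃))⁻¹ := by
          nlinarith
    _ = (W₀.baseChange ℝ).realPeriod := hΩ.symm

/-- **WGS ⟹ PeriodLowerBound, unconditionally** (the converse real-period bound discharged). -/
theorem periodLowerBound_of_weakGenSzpiro'
    (hwgs : ∃ K C : ℝ, ∀ W₀ : WeierstrassCurve ℤ, (W₀.baseChange ℚ).IsElliptic →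
      (∀ v : HeightOneSpectrum ℤ, (W₀.baseChange ℚ).IsMinimalAt v) →
        ((max |W₀.Δ| (|W₀.c₄| ^ 3) : ℤ) : ℝ) ≤ C * (((W₀.baseChange ℚ).conductorNorm ℤ : ℕ) : ℝ) ^ K) :
    ∃ K C : ℝ, 0 < C ∧ ∀ W₀ : WeierstrassCurve ℤ, (W₀.baseChange ℚ).IsElliptic →
      (∀ v : HeightOneSpectrum ℤ, (W₀.baseChange ℚ).IsMinimalAt v) →
        C * (((W₀.baseChange ℚ).conductorNorm ℤ : ℕ) : ℝ) ^ (-K) ≤ (W₀.baseChange ℝ).realPeriod :=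
  periodLowerBound_of_weakGenSzpiro realPeriodLowerBound hwgs

/-- Real bookkeeping behind both `PeriodLowerBound ∧ A0 ⟹ WGS` and stub E: from
`C·n^{-K} ≤ Ω ≤ C₀·M^{-1/12}·log(2+M)` with `M, n ≥ 1`, `C > 0` (any real `K`) one gets
`M ≤ (C'/C)^{24} · n^{24K}` with `C' := max C₀ 1 · 24 · 3^{1/24}`. -/
theorem PeriodCalibration.max_le_of_period_bounds {C K C₀ M n Ω : ℝ} (hC : 0 < C)
    (hM : 1 ≤ M) (hn : 1 ≤ n) (hlow : C * n ^ (-K) ≤ Ω)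
    (hup : Ω ≤ C₀ * M ^ (-(1 : ℝ) / 12) * Real.log (2 + M)) :
    M ≤ ((max C₀ 1 * 24 * (3 : ℝ) ^ ((1 : ℝ) / 24)) / C) ^ (24 : ℕ) * n ^ (24 * K) := by
  have hM0 : 0 < M := by linarith
  have hn0 : 0 < n := by linarith
  set C₁ : ℝ := max C₀ 1 with hC₁
  have hC₁1 : 1 ≤ C₁ := le_max_right _ _
  have h312 : 0 < (3 : ℝ) ^ ((1 : ℝ) / 24) := Real.rpow_pos_of_pos (by norm_num) _
  set C' : ℝ := C₁ * 24 * (3 : ℝ) ^ ((1 : ℝ) / 24) with hC'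
  have hC'0 : 0 < C' := by positivity
  -- `log(2+M) ≤ 24 (2+M)^{1/24} ≤ 24·3^{1/24} M^{1/24}`
  have hlog : Real.log (2 + M) ≤ 24 * (3 : ℝ) ^ ((1 : ℝ) / 24) * M ^ ((1 : ℝ) / 24) := by
    have h1 : Real.log (2 + M) ≤ (2 + M) ^ ((1 : ℝ) / 24) / ((1 : ℝ) / 24) :=
      Real.log_le_rpow_div (by linarith) (by norm_num)
    have h2 : (2 + M) ^ ((1 : ℝ) / 24) ≤ (3 * M) ^ ((1 : ℝ) / 24) :=
      Real.rpow_le_rpow (by linarith) (by linarith) (by norm_num)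
    rw [Real.mul_rpow (by norm_num) hM0.le] at h2
    rw [div_eq_mul_inv, show ((1 : ℝ) / 24)⁻¹ = 24 by norm_num] at h1
    nlinarith
  have hlog0 : 0 ≤ Real.log (2 + M) := Real.log_nonneg (by linarith)
  have hMpow : 0 < M ^ (-(1 : ℝ) / 12) := Real.rpow_pos_of_pos hM0 _
  -- `Ω ≤ C' M^{-1/24}`
  have hup' : Ω ≤ C' * M ^ (-(1 : ℝ) / 24) := by
    have h1 : C₀ * M ^ (-(1 : ℝ) / 12) * Real.log (2 + M) ≤
        C₁ * M ^ (-(1 : ℝ) / 12) * Real.log (2 + M) := by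
      apply mul_le_mul_of_nonneg_right _ hlog0
      exact mul_le_mul_of_nonneg_right (le_max_left _ _) hMpow.le
    have h2 : C₁ * M ^ (-(1 : ℝ) / 12) * Real.log (2 + M) ≤
        C₁ * M ^ (-(1 : ℝ) / 12) * (24 * (3 : ℝ) ^ ((1 : ℝ) / 24) * M ^ ((1 : ℝ) / 24)) :=
      mul_le_mul_of_nonneg_left hlog (by positivity)
    have h3 : C₁ * M ^ (-(1 : ℝ) / 12) * (24 * (3 : ℝ) ^ ((1 : ℝ) / 24) * M ^ ((1 : ℝ) / 24)) =
        C' * M ^ (-(1 : ℝ) / 24) := by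
      have : M ^ (-(1 : ℝ) / 12) * M ^ ((1 : ℝ) / 24) = M ^ (-(1 : ℝ) / 24) := by
        rw [← Real.rpow_add hM0]; norm_num
      rw [hC', ← this]; ring
    linarith
  -- combine: `C n^{-K} ≤ C' M^{-1/24}` ⇒ `M^{1/24} ≤ (C'/C) n^K`
  have hcomb : C * n ^ (-K) ≤ C' * M ^ (-(1 : ℝ) / 24) := le_trans hlow hup'
  have hnK : 0 < n ^ K := Real.rpow_pos_of_pos hn0 _
  have hM24 : 0 < M ^ ((1 : ℝ) / 24) := Real.rpow_pos_of_pos hM0 _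
  have hkey : M ^ ((1 : ℝ) / 24) ≤ C' / C * n ^ K := by
    rw [Real.rpow_neg hn0.le, show (-(1 : ℝ) / 24) = -((1 : ℝ) / 24) by ring,
      Real.rpow_neg hM0.le] at hcomb
    -- hcomb : C * (n^K)⁻¹ ≤ C' * (M^{1/24})⁻¹
    rw [div_mul_eq_mul_div, le_div_iff₀ hC]
    have h1 : C * (n ^ K)⁻¹ * (n ^ K * M ^ ((1 : ℝ) / 24)) ≤
        C' * (M ^ ((1 : ℝ) / 24))⁻¹ * (n ^ K * M ^ ((1 : ℝ) / 24)) :=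
      mul_le_mul_of_nonneg_right hcomb (by positivity)
    have h2 : C * (n ^ K)⁻¹ * (n ^ K * M ^ ((1 : ℝ) / 24)) = M ^ ((1 : ℝ) / 24) * C := by
      field_simp
    have h3 : C' * (M ^ ((1 : ℝ) / 24))⁻¹ * (n ^ K * M ^ ((1 : ℝ) / 24)) = C' * n ^ K := by
      field_simp
    linarith
  -- raise to the 24th power
  have hCC : 0 ≤ C' / C * n ^ K := by positivity
  have h24 : (M ^ ((1 : ℝ) / 24)) ^ (24 : ℕ) ≤ (C' / C * n ^ K) ^ (24 : ℕ) :=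
    pow_le_pow_left₀ hM24.le hkey 24
  have hM' : (M ^ ((1 : ℝ) / 24)) ^ (24 : ℕ) = M := by
    rw [← Real.rpow_natCast, ← Real.rpow_mul hM0.le]; norm_num
  have hR : (C' / C * n ^ K) ^ (24 : ℕ) = (C' / C) ^ (24 : ℕ) * n ^ (24 * K) := by
    rw [mul_pow, ← Real.rpow_natCast (n ^ K), ← Real.rpow_mul hn0.le]
    congr 1; congr 1; push_cast; ring
  rw [hM'] at h24
  rw [hC'] at hR
  rw [hR] at h24
  exact h24

/-- **PeriodLowerBound ∧ A0 ⟹ WGS (weak generalized Szpiro with a constant, ALL minimal models).**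
Together with `periodLowerBound_of_weakGenSzpiro'` this is the kernel-checked calibration
`PeriodLowerBound ↔ WeakGeneralizedSzpiro` modulo A0 (`RealPeriodUpperBound`, stub D of the line). -/
theorem weakGenSzpiro_of_periodBounds
    (hA0 : ∃ C₀ : ℝ, ∀ W₀ : WeierstrassCurve ℤ, W₀.Δ ≠ 0 →
      (W₀.baseChange ℝ).realPeriod ≤
        C₀ * ((max |W₀.Δ| (|W₀.c₄| ^ 3) : ℤ) : ℝ) ^ (-(1 : ℝ) / 12) *
          Real.log (2 + ((max |W₀.Δ| (|W₀.c₄| ^ 3) : ℤ) : ℝ)))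
    (hPLB : ∃ K C : ℝ, 0 < C ∧ ∀ W₀ : WeierstrassCurve ℤ, (W₀.baseChange ℚ).IsElliptic →
      (∀ v : HeightOneSpectrum ℤ, (W₀.baseChange ℚ).IsMinimalAt v) →
        C * (((W₀.baseChange ℚ).conductorNorm ℤ : ℕ) : ℝ) ^ (-K) ≤ (W₀.baseChange ℝ).realPeriod) :
    ∃ K C : ℝ, ∀ W₀ : WeierstrassCurve ℤ, (W₀.baseChange ℚ).IsElliptic →
      (∀ v : HeightOneSpectrum ℤ, (W₀.baseChange ℚ).IsMinimalAt v) →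
        ((max |W₀.Δ| (|W₀.c₄| ^ 3) : ℤ) : ℝ) ≤ C * (((W₀.baseChange ℚ).conductorNorm ℤ : ℕ) : ℝ) ^ K := by
  obtain ⟨C₀, hA0⟩ := hA0
  obtain ⟨K, C, hC, hPLB⟩ := hPLB
  refine ⟨24 * K, ((max C₀ 1 * 24 * (3 : ℝ) ^ ((1 : ℝ) / 24)) / C) ^ (24 : ℕ), fun W₀ hE hmin => ?_⟩
  haveI := hE
  have hn1 : (1 : ℝ) ≤ (((W₀.baseChange ℚ).conductorNorm ℤ : ℕ) : ℝ) := by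
    exact_mod_cast WeierstrassCurve.conductorNorm_pos_holds (W₀.baseChange ℚ)
  have hΔ : W₀.Δ ≠ 0 := PeriodCalibration.Δ_ne_zero_of_isElliptic W₀ hE
  have hM1 : (1 : ℝ) ≤ ((max |W₀.Δ| (|W₀.c₄| ^ 3) : ℤ) : ℝ) := by
    have h1 : (1 : ℤ) ≤ max |W₀.Δ| (|W₀.c₄| ^ 3) := le_trans (Int.one_le_abs hΔ) (le_max_left _ _)
    exact_mod_cast h1
  exact PeriodCalibration.max_le_of_period_bounds hC hM1 hn1 (hPLB W₀ hE hmin) (hA0 W₀ hΔ)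


/-- **STUB `stub_periodCalibration` (registered calibration stub of line `Sketch`).**  Given A0
(`RealPeriodUpperBound`, landed as `stub_realPeriodUpperBound` modulo the analytic stubs), the period
lower bound `PeriodLowerBound` is EQUIVALENT to weak generalized Szpiro with a constant for all
minimal models (`WeakGeneralizedSzpiro`, the hypothesis of the landed
`someWindowSaving_of_weakGenSzpiro`): ⟹ by `weakGenSzpiro_of_periodBounds`, ⟸ unconditionally by
`periodLowerBound_of_weakGenSzpiro'`.  This is the disprover's calibration target
"`PeriodLowerBound ↔ CofiniteWeakGenSzpiro` (A0 and its converse)" made exact: the period face of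
card A carries exactly the content of weak generalized Szpiro. -/
theorem stub_periodCalibration :
    (∃ C₀ : ℝ, ∀ W₀ : WeierstrassCurve ℤ, W₀.Δ ≠ 0 → (W₀.baseChange ℝ).realPeriod ≤
      C₀ * ((max |W₀.Δ| (|W₀.c₄| ^ 3) : ℤ) : ℝ) ^ (-(1 : ℝ) / 12) *
        Real.log (2 + ((max |W₀.Δ| (|W₀.c₄| ^ 3) : ℤ) : ℝ))) →
    ((∃ K C : ℝ, 0 < C ∧ ∀ W₀ : WeierstrassCurve ℤ, (W₀.baseChange ℚ).IsElliptic →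
      (∀ v : IsDedekindDomain.HeightOneSpectrum ℤ, (W₀.baseChange ℚ).IsMinimalAt v) →
        C * (((W₀.baseChange ℚ).conductorNorm ℤ : ℕ) : ℝ) ^ (-K) ≤ (W₀.baseChange ℝ).realPeriod) ↔
    (∃ K C : ℝ, ∀ W₀ : WeierstrassCurve ℤ, (W₀.baseChange ℚ).IsElliptic →
      (∀ v : IsDedekindDomain.HeightOneSpectrum ℤ, (W₀.baseChange ℚ).IsMinimalAt v) →
        ((max |W₀.Δ| (|W₀.c₄| ^ 3) : ℤ) : ℝ) ≤
          C * (((W₀.baseChange ℚ).conductorNorm ℤ : ℕ) : ℝ) ^ K)) :=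
  fun hA0 => ⟨weakGenSzpiro_of_periodBounds hA0, periodLowerBound_of_weakGenSzpiro'⟩

end Summit.ABC.ABC.Theorems

end
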